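import Mathlib
import Summits.ValiantsHypothesis.ValiantsHypothesis.Theorems.BarrierLeverPartitionMinorsHitByVPHiddenStatesHubWide

/-!
# Route BarrierLever — item `PartitionMinorsHitByVP` (stmt-ValiantsHypothesis-19717), line `hidden-states`,
# node restricted to LOWER row families (`LowerNode.Stmt.universalJoinWideLower`): wide hub joins by DEGREE AVERAGING —
# the lower node at `h = 19` for every `r ≤ 517 158`

Helper file (`--supports stmt-ValiantsHypothesis-19717`; cell valiant-natproofs, rung V4, 𝒟-side door (c); prover seat
val-np-p6 gen 10, registered line `Cruxes/PartitionMinorsHitByVP/Lines/hidden_states.lean` v7). Definition-free; closes NO item.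

THE POINT. `HubWide.universalJoinWide_body_balanced` (this seat, p609852) serves every injective row family having a coordinate with
`2h(l+1)` members on each side. For an arbitrary injective family the best balance guarantee is `≈ 2r/h`
(`HubAxis.exists_balanced_coord`) or the trivial `r − 2^{h−1}`; for a family whose range is a LOWER SET it is much better:

* `card_mem_le_card_not_mem_of_lower` — in a lower family every coordinate lies in at most half of the members (`S ↦ S ∖ {y}` injects
  the members containing `y` into those avoiding it);
* `sum_card_eq_sum_deg`, `exists_coord_deg_ge` — some coordinate lies in at least `(Σ_i |u i|)/h` members (double counting);
* `mul_le_sum_card_add` — for ANY injective family and any `t`, `t·r ≤ Σ_i |u i| + Σ_{j<t} #{S ⊆ Fin h : |S| ≤ j}`, and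
  `card_filter_card_le_le` bounds the last count by `Σ_{i≤j} C(h,i)`: distinct sets cannot all be small.

Hence `universalJoinWide_body_lower`: if `h·2h(l+1) + Σ_{j<t} Σ_{i≤j} C(h,i) ≤ t·r` (some `t`), `l+1 ≤ h³` and `r ≤ 2h(h³+1+l)`, ONE legal
wide design serves EVERY injective lower family of size `r`. At `h = 19` (`t = 14`, `Σ = 2 365 704`) this covers every `r ≤ 517 158`
(`universalJoinWideLower_nineteen`; below `289 560` all families are served, `HubWide.universalJoinWide_of_le_hub`). So for LOWER families —
the case the crux needs (`DownCompression.partitionMinorsHitByVP_of_lowerSets`) — the first open cell of the node is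
`h = 19, r ∈ (517 158, 524 288]`: down-sets of CO-SIZE `< 7 130` only, at the very top of the cube, just beyond the hub capacity
`4h⁴ = 521 284` for the largest of them.

WHAT THIS IS NOT: the registered stubs (`∃ h₁ ∀ h ≥ h₁ …`) are untouched by finite-`h` ranges; nothing on crux 14610 or VP ≠ VNP.
-/

set_option linter.dupNamespace false

namespace Summit.ValiantsHypothesis.ValiantsHypothesis.Theorems.BarrierLever.HiddenStates

open Finset Matrix

noncomputable section

namespace HubWide

/-! ## 1. Degree bookkeeping for injective and for lower families -/

/-- **Lower families are balanced towards avoidance**: every coordinate lies in at most as many members as avoid it. -/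
theorem card_mem_le_card_not_mem_of_lower {h r : ℕ} (u : Fin r → Finset (Fin h)) (hu : Function.Injective u)
    (hlow : IsLowerSet (Set.range u)) (y : Fin h) :
    (Finset.univ.filter fun i : Fin r => y ∈ u i).card ≤ (Finset.univ.filter fun i : Fin r => y ∉ u i).card := by
  classical
  -- the member `u i ∖ {y}` is again a member
  have hmem : ∀ i, ∃ i', u i' = (u i).erase y := fun i =>
    hlow (Finset.erase_subset y (u i)) ⟨i, rfl⟩
  choose g hg using hmem
  refine Finset.card_le_card_of_injOn g (fun i hi => ?_) (fun i hi i' hi' hii => ?_)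
  · simp only [Finset.coe_filter, Finset.mem_univ, true_and, Set.mem_setOf_eq] at hi ⊢
    rw [hg]
    exact Finset.notMem_erase y (u i)
  · simp only [Finset.coe_filter, Finset.mem_univ, true_and, Set.mem_setOf_eq] at hi hi'
    apply hu
    have := congrArg (insert y) ((hg i).symm.trans ((congrArg u hii).trans (hg i')))
    rwa [Finset.insert_erase hi, Finset.insert_erase hi'] at this

/-- Double counting: the total size of the members is the sum of the coordinate degrees. -/
theorem sum_card_eq_sum_deg {h r : ℕ} (u : Fin r → Finset (Fin h)) :
    ∑ i : Fin r, (u i).card = ∑ y : Fin h, (Finset.univ.filter fun i : Fin r => y ∈ u i).card := by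
  classical
  have h1 : ∀ i : Fin r, (u i).card = ∑ y : Fin h, if y ∈ u i then 1 else 0 := by
    intro i
    rw [← Finset.card_filter]
    congr 1
    ext y
    simp
  simp_rw [h1, Finset.card_filter]
  exact Finset.sum_comm

/-- **Some coordinate has at least average degree**: `Σ_i |u i| ≤ h · deg(y)` for some `y` (when `h ≥ 1`). -/
theorem exists_coord_deg_ge {h r : ℕ} (u : Fin r → Finset (Fin h)) (h1 : 1 ≤ h) :
    ∃ y : Fin h, ∑ i : Fin r, (u i).card ≤ h * (Finset.univ.filter fun i : Fin r => y ∈ u i).card := by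
  classical
  have hne : (Finset.univ : Finset (Fin h)).Nonempty := ⟨⟨0, h1⟩, Finset.mem_univ _⟩
  obtain ⟨y, -, hy⟩ := Finset.exists_max_image Finset.univ
    (fun y : Fin h => (Finset.univ.filter fun i : Fin r => y ∈ u i).card) hne
  refine ⟨y, ?_⟩
  rw [sum_card_eq_sum_deg]
  calc ∑ y' : Fin h, (Finset.univ.filter fun i : Fin r => y' ∈ u i).card
      ≤ ∑ _y' : Fin h, (Finset.univ.filter fun i : Fin r => y ∈ u i).card :=
        Finset.sum_le_sum fun y' _ => hy y' (Finset.mem_univ _)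
    _ = h * (Finset.univ.filter fun i : Fin r => y ∈ u i).card := by
        rw [Finset.sum_const, Finset.card_univ, Fintype.card_fin, smul_eq_mul]

/-- The number of subsets of `Fin h` with at most `j` elements is at most `Σ_{i ≤ j} C(h, i)`. -/
theorem card_powerset_filter_le (h j : ℕ) :
    ((Finset.univ : Finset (Fin h)).powerset.filter fun S => S.card ≤ j).card ≤
      ∑ i ∈ Finset.range (j + 1), Nat.choose h i := by
  classical
  have hsub : ((Finset.univ : Finset (Fin h)).powerset.filter fun S => S.card ≤ j) ⊆
      (Finset.range (j + 1)).biUnion fun i => Finset.powersetCard i (Finset.univ : Finset (Fin h)) := by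
    intro S hS
    rw [Finset.mem_filter] at hS
    rw [Finset.mem_biUnion]
    exact ⟨S.card, Finset.mem_range.mpr (by omega), Finset.mem_powersetCard.mpr ⟨Finset.subset_univ _, rfl⟩⟩
  refine (Finset.card_le_card hsub).trans (Finset.card_biUnion_le.trans ?_)
  refine Finset.sum_le_sum fun i _ => ?_
  rw [Finset.card_powersetCard, Finset.card_univ, Fintype.card_fin]

/-- An injective family has at most `Σ_{i≤j} C(h,i)` members of size `≤ j`. -/
theorem card_filter_card_le_le {h r : ℕ} (u : Fin r → Finset (Fin h)) (hu : Function.Injective u) (j : ℕ) :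
    (Finset.univ.filter fun i : Fin r => (u i).card ≤ j).card ≤ ∑ i ∈ Finset.range (j + 1), Nat.choose h i := by
  classical
  refine le_trans ?_ (card_powerset_filter_le h j)
  refine Finset.card_le_card_of_injOn u (fun i hi => ?_) (fun i _ i' _ hii => hu hii)
  have hi' : (u i).card ≤ j := by simpa using hi
  rw [Finset.mem_coe, Finset.mem_filter, Finset.mem_powerset]
  exact ⟨Finset.subset_univ _, hi'⟩

/-- **Distinct sets cannot all be small**: `t·r ≤ Σ_i |u i| + Σ_{j<t} Σ_{i≤j} C(h,i)` for every injective family and every `t`. -/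
theorem mul_le_sum_card_add {h r : ℕ} (u : Fin r → Finset (Fin h)) (hu : Function.Injective u) (t : ℕ) :
    t * r ≤ ∑ i : Fin r, (u i).card + ∑ j ∈ Finset.range t, ∑ i ∈ Finset.range (j + 1), Nat.choose h i := by
  classical
  -- pointwise: t ≤ |u i| + #{j < t : |u i| ≤ j}
  have hpt : ∀ i : Fin r, t ≤ (u i).card + ((Finset.range t).filter fun j => (u i).card ≤ j).card := by
    intro i
    have hcov : Finset.range t ⊆ Finset.range (u i).card ∪ (Finset.range t).filter fun j => (u i).card ≤ j := by
      intro j hj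
      rw [Finset.mem_union, Finset.mem_filter, Finset.mem_range]
      by_cases hjc : j < (u i).card
      · exact Or.inl hjc
      · exact Or.inr ⟨hj, by omega⟩
    have := (Finset.card_le_card hcov).trans (Finset.card_union_le _ _)
    simpa using this
  -- sum over i and swap the double count
  have hsum : ∑ i : Fin r, ((Finset.range t).filter fun j => (u i).card ≤ j).card
      = ∑ j ∈ Finset.range t, (Finset.univ.filter fun i : Fin r => (u i).card ≤ j).card := by
    simp_rw [Finset.card_filter]
    exact Finset.sum_comm
  calc t * r = ∑ _i : Fin r, t := by rw [Finset.sum_const, Finset.card_univ, Fintype.card_fin, smul_eq_mul, mul_comm]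
    _ ≤ ∑ i : Fin r, ((u i).card + ((Finset.range t).filter fun j => (u i).card ≤ j).card) :=
        Finset.sum_le_sum fun i _ => hpt i
    _ = ∑ i : Fin r, (u i).card + ∑ j ∈ Finset.range t, (Finset.univ.filter fun i : Fin r => (u i).card ≤ j).card := by
        rw [Finset.sum_add_distrib, hsum]
    _ ≤ ∑ i : Fin r, (u i).card + ∑ j ∈ Finset.range t, ∑ i ∈ Finset.range (j + 1), Nat.choose h i := by
        have := Finset.sum_le_sum (s := Finset.range t) fun j _ => card_filter_card_le_le u hu j
        omega

/-! ## 2. The lower node by degree averaging -/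

/-- **The node for LOWER families by degree averaging.** If `l + 1 ≤ h³`, `r ≤ 2h(h³+1+l)` and, for some `t`,
`h·2h(l+1) + Σ_{j<t} Σ_{i≤j} C(h,i) ≤ t·r`, then ONE legal wide join threshold design (`2h` pieces, `h³` states) serves EVERY
injective row family of size `r` whose range is a lower set (the body of `LowerNode.Stmt.universalJoinWideLower` at `(h, r)`). -/
theorem universalJoinWide_body_lower (h l r t : ℕ) (h1 : 1 ≤ h) (hl : l + 1 ≤ h * h * h)
    (hr : r ≤ (h + h) * (h * h * h + 1 + l))
    (ht : h * ((h + h) * (l + 1)) + ∑ j ∈ Finset.range t, ∑ i ∈ Finset.range (j + 1), Nat.choose h i ≤ t * r) :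
    ∃ (m K : ℕ) (W : Fin m → ℕ) (wt : Fin m → Fin K → ℕ) (e : Fin r → Fin m × Finset (Fin K)),
      m ≤ h + h ∧ K ≤ h * h * h ∧ Function.Injective e ∧
      (∀ x : Fin m × Finset (Fin K), x ∉ Set.range e →
        ∀ i, W (e i).1 + ∑ k ∈ (e i).2, wt (e i).1 k < W x.1 + ∑ k ∈ x.2, wt x.1 k) ∧
      ∀ u : Fin r → Finset (Fin h), Function.Injective u → IsLowerSet (Set.range u) →
        ∃ tx : Fin m → Option (Fin K) → Fin h → ℂ,
          (Matrix.of fun i k : Fin r =>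
            ∏ a ∈ u i, (tx (e k).1 none a + ∑ q ∈ (e k).2, tx (e k).1 (some q) a)).det ≠ 0 := by
  obtain ⟨m, K, W, wt, e, hm, hK, he, hthr, hgood⟩ := universalJoinWide_body_balanced h l r hl hr
  refine ⟨m, K, W, wt, e, hm, hK, he, hthr, fun u hu hlow => hgood u hu ?_⟩
  obtain ⟨y, hy⟩ := exists_coord_deg_ge u h1
  have hsum := mul_le_sum_card_add u hu t
  have hdeg : (h + h) * (l + 1) ≤ (Finset.univ.filter fun i : Fin r => y ∈ u i).card := by
    have h0 : 0 < h := h1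
    have : h * ((h + h) * (l + 1)) ≤ h * (Finset.univ.filter fun i : Fin r => y ∈ u i).card := by omega
    exact Nat.le_of_mul_le_mul_left this h0
  exact ⟨y, hdeg.trans (card_mem_le_card_not_mem_of_lower u hu hlow y), hdeg⟩

/-! ## 3. `h = 19`: the lower node up to `r = 517 158` -/

/-- The degree-averaging constant at `h = 19`, `t = 14`: `Σ_{j<14} Σ_{i≤j} C(19,i) = 2 365 704`. -/
theorem sum_choose_nineteen_fourteen :
    ∑ j ∈ Finset.range 14, ∑ i ∈ Finset.range (j + 1), Nat.choose 19 i = 2365704 := by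
  simp only [Finset.sum_range_succ, Finset.sum_range_zero, zero_add]
  norm_num [Nat.choose]

/-- **The node for LOWER families at `h = 19` for every `r ≤ 517 158`.** (All families for `r ≤ 289 560` by
`universalJoinWide_of_le_hub`; above, hub joins with `l = ⌈(r − 260 680)/38⌉` married pairs per piece and the coordinate of
maximal degree: `19·deg ≥ 14 r − 2 365 704 ≥ 19·38(l+1)`.) -/
theorem universalJoinWideLower_nineteen (r : ℕ) (hr : r ≤ 517158) :
    ∃ (m K : ℕ) (W : Fin m → ℕ) (wt : Fin m → Fin K → ℕ) (e : Fin r → Fin m × Finset (Fin K)),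
      m ≤ 19 + 19 ∧ K ≤ 19 * 19 * 19 ∧ Function.Injective e ∧
      (∀ x : Fin m × Finset (Fin K), x ∉ Set.range e →
        ∀ i, W (e i).1 + ∑ k ∈ (e i).2, wt (e i).1 k < W x.1 + ∑ k ∈ x.2, wt x.1 k) ∧
      ∀ u : Fin r → Finset (Fin 19), Function.Injective u → IsLowerSet (Set.range u) →
        ∃ tx : Fin m → Option (Fin K) → Fin 19 → ℂ,
          (Matrix.of fun i k : Fin r =>
            ∏ a ∈ u i, (tx (e k).1 none a + ∑ q ∈ (e k).2, tx (e k).1 (some q) a)).det ≠ 0 := by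
  by_cases hsmall : r ≤ (19 + 19) * (19 * 19 * 19 + 1) + 4 * (19 * 19 * 19) + 4 * (19 * 19)
  · obtain ⟨m, K, W, wt, e, hm, hK, he, hthr, hgood⟩ := universalJoinWide_of_le_hub 19 r (by norm_num) hsmall
    exact ⟨m, K, W, wt, e, hm, hK, he, hthr, fun u hu _ => hgood u hu⟩
  push Not at hsmall
  set l := (r - (19 + 19) * (19 * 19 * 19 + 1) + 37) / 38 with hl
  refine universalJoinWide_body_lower 19 l r 14 (by norm_num) ?_ ?_ ?_
  · omega
  · omega
  · rw [sum_choose_nineteen_fourteen]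
    omega

/-- Bookkeeping: the first cell of the LOWER node not covered at `h = 19` is `r = 517 159 = 2^19 − 7 129`, beyond which only down-sets
of co-size `< 7 130` remain; the largest of them exceed the hub capacity `4h⁴ = 521 284` (`HubWide.hub_capacity_lt_two_pow_nineteen`). -/
theorem lower_window_nineteen : 2 ^ 19 - 517158 = 7130 ∧ (19 + 19) * (19 * 19 * 19 + 19 * 19 * 19) = 521284 := by norm_num

end HubWide

end

end Summit.ValiantsHypothesis.ValiantsHypothesis.Theorems.BarrierLever.HiddenStates
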